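import Literature.Analysis.FluidPDE.DuchonRobertMollifierKernel
import Literature.Analysis.FluidPDE.OnsagerCCFSEnergyProofs
import Literature.Analysis.FluidPDE.OnsagerCCFSTestField
import Literature.Analysis.FluidPDE.MollifiedLimits
import HarnessLib

/-!
# Duchon–Robert's local energy balance: the mollified transport terms converge (discharge)

Sorry-free proof of the named fact `Literature.Analysis.FluidPDE.Torus.tendsto_mollified_transport`
of `Literature/Analysis/FluidPDE/DuchonRobertLocalBalance` (Duchon–Robert 2000, proof of
Prop. 1, p. 251, "letting `ε` go to `0`" in the cubic terms; Evans, *PDE*, App. C, Thm. 7 (iv):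
`f^ε → f` in `L^p_loc`, `1 ≤ p < ∞`).

## Proof architecture (as printed: Evans–Gariepy, Thm. 4.1 (iii), proof, step 3)

For the torus kernels `K_ε = Torus.mollifierKernel φ ε` of a Euclidean mollifier `φ`
(smooth, even, nonnegative, unit mass — `DuchonRobertLocalBalance`; continuous and supported in
the torus ball of radius `ε (R + 1)` when `tsupport φ ⊆ B̄(0, R)` — the sibling support file
`DuchonRobertMollifierKernel`, `Torus.support_mollifierKernel_subset`):

* `Torus.tendsto_eLpNorm_conv_sub_self_of_kernels` — **`L^p` convergence of mollification on
  `T^d`, `1 ≤ p < ∞`**: `‖θ ⋆ kₙ - θ‖_{L^p} → 0` along continuous kernels `kₙ ≥ 0` of unit mass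
  supported in balls of radii `δₙ → 0` (the printed `3δ`-argument: a continuous `g` with
  `‖θ - g‖_p ≤ δ` — Mathlib's `MemLp.exists_boundedContinuous_eLpNorm_sub_le` —, the contraction
  `‖(θ - g) ⋆ kₙ‖_p ≤ ‖θ - g‖_p` — Young's inequality, the tree's `Torus.eLpNorm_convolution_le` —,
  and uniform convergence `g ⋆ kₙ → g` — the tree's `Torus.exists_forall_dist_convolution_le`);
  the exponent-`2` case is the tree's `Torus.tendsto_eLpNorm_convolution_sub_self`, whose proof is
  repeated verbatim for general `p`;
* `Torus.tendsto_eLpNorm_vecConv_sub_self_of_kernels`, `Torus.eLpNorm_vecConv_le_card_mul` — the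
  componentwise vector versions (`‖w‖ ≤ ∑ᵢ ‖wᵢ‖`);
* slice lemmas (`Torus.tendsto_sliceA/B/C/D`, `Torus.enorm_sliceA/B/C/D_le`): at a fixed time, for
  `v ∈ L³(T^d; ℝ^d)` and bounded continuous weights, the four pairings converge (Hölder
  `(1, ∞)`, `(3/2, 3)`: the tree's `FluidPDE.tendsto_setIntegral_mul_bilin`) and are bounded by
  `C ‖v‖₃³` (resp. `C ‖v‖₃²`);
* `Torus.tendsto_mollified_transport_holds` — the discharge: right limits at `0` are tested along
  sequences `εₙ → 0⁺` (`Torus.tendsto_nhdsGT_zero_of_seq`), at a.e. time `u(t) ∈ L³`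
  (`Torus.ae_memLp_three_of_lintegral`), and in time the slice limits are integrated by dominated
  convergence with the bound `C (1 + ∫ ‖u(t)‖³) ∈ L¹(0,T)`.

## References

* L. C. Evans, *Partial Differential Equations*, 2nd ed., AMS GSM 19 (2010), App. C, Thm. 7
  (Properties of mollifiers) (iv). [Evans2010]
* L. C. Evans, R. F. Gariepy, *Measure Theory and Fine Properties of Functions*, revised ed.,
  CRC Press (2015), §4.2.1, Thm. 4.1 (Properties of mollifiers) (ii)–(iii) and step 3 of its
  proof. [EvansGariepy2015]
* J. Duchon, R. Robert, *Inertial energy dissipation for weak solutions of incompressible Euler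
  and Navier–Stokes equations*, Nonlinearity 13 (2000) 249–255, proof of Prop. 1, p. 251.
  [DuchonRobert2000]

## Mathlib search

Mathlib (this pin) has the density of bounded continuous functions in `L^p`
(`MemLp.exists_boundedContinuous_eLpNorm_sub_le`), uniform approximate identities
(`dist_convolution_le`), Hölder (`eLpNorm_le_eLpNorm_mul_eLpNorm_of_nnnorm`) and dominated
convergence; no `L^p` convergence of mollification on the torus beyond the tree's `L²` lemmas
`Torus.tendsto_eLpNorm_convolution_sub_self` (`FunctionSpaces/TorusConvolution`) and
`Torus.tendsto_eLpNorm_convolution_mollifierKernel_sub_self` (`DuchonRobertMollifierKernel`)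
(searched `tendsto_eLpNorm` + `convolution`, `mollifier`, `UnitAddTorus` + `convolution`).
-/

noncomputable section

open MeasureTheory TopologicalSpace Set Function Filter Topology Metric
open scoped ENNReal NNReal Convolution ContDiff InnerProductSpace RealInnerProductSpace

namespace Literature.Analysis.FluidPDE.Torus

variable {d : Type*} [Fintype d] [DecidableEq d]

/-! ## `L^p` convergence of mollification on `T^d`, `1 ≤ p < ∞` -/

section LpConvergence

omit [DecidableEq d] in
/-- **`L^p` convergence of mollifications, `1 ≤ p < ∞`** (Evans, App. C, Thm. 7 (iv);
Evans–Gariepy, Thm. 4.1 (iii), on `T^d`): for `θ ∈ L^p(T^d)` and continuous kernels `kₙ ≥ 0` of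
unit mass with `support kₙ ⊆ B(0, δₙ)`, `δₙ → 0`, one has `‖θ ⋆ kₙ - θ‖_{L^p} → 0`. The printed
`3δ`-argument: a (bounded) continuous `g` with `‖θ - g‖_p ≤ δ` (density, Mathlib's
`MemLp.exists_boundedContinuous_eLpNorm_sub_le`), the contraction `‖(θ - g) ⋆ kₙ‖_p ≤ ‖θ - g‖_p`
(Young's inequality, `Torus.eLpNorm_convolution_le`) and the uniform convergence `g ⋆ kₙ → g`
(`Torus.exists_forall_dist_convolution_le`); verbatim the tree's exponent-`2` proof
`Torus.tendsto_eLpNorm_convolution_sub_self`. [cite: EvansGariepy2015, §4.2.1 Thm. 4.1 (iii)] -/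
theorem tendsto_eLpNorm_conv_sub_self_of_kernels {p : ℝ≥0∞} (hp1 : 1 ≤ p) (hp : p ≠ ⊤)
    {θ : UnitAddTorus d → ℝ} (hθ : MemLp θ p volume)
    {k : ℕ → UnitAddTorus d → ℝ} {δ : ℕ → ℝ} (hk_nn : ∀ n y, 0 ≤ k n y)
    (hk_int : ∀ n, ∫ y, k n y = 1) (hk_supp : ∀ n, support (k n) ⊆ ball 0 (δ n))
    (hk_cont : ∀ n, Continuous (k n)) (hδ : Tendsto δ atTop (𝓝 0)) :
    Tendsto (fun n => eLpNorm (θ ⋆ k n - θ) p volume) atTop (𝓝 0) := by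
  have hθi : Integrable θ volume := hθ.integrable hp1
  have hk1 : ∀ n, ∫⁻ y, ‖k n y‖ₑ = 1 := fun n => by
    rw [FunctionSpaces.Torus.lintegral_enorm_eq_ofReal_integral
      (hk_cont n).integrable_unitAddTorus (hk_nn n), hk_int n, ENNReal.ofReal_one]
  rw [ENNReal.tendsto_atTop_zero]
  intro ε hε
  -- work with `ε' = min ε 1 < ∞` and `η = ε' / 3`
  set ε' : ℝ≥0∞ := min ε 1 with hε'
  have hε'0 : ε' ≠ 0 := (lt_min hε zero_lt_one).ne'
  have hε't : ε' ≠ ⊤ := (min_le_right _ _).trans_lt ENNReal.one_lt_top |>.ne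
  set η : ℝ≥0∞ := ε' / 3 with hη
  have hη0 : η ≠ 0 := (ENNReal.div_pos_iff.2 ⟨hε'0, by norm_num⟩).ne'
  have hηt : η ≠ ⊤ := ENNReal.div_ne_top hε't (by norm_num)
  -- a continuous `g` close to `θ` in `L^p`
  obtain ⟨gb, hgθ, -⟩ := hθ.exists_boundedContinuous_eLpNorm_sub_le hp hη0
  set g : UnitAddTorus d → ℝ := ⇑gb with hg_def
  have hgc : Continuous g := gb.continuous
  have hgi : Integrable g volume := hgc.integrable_unitAddTorus
  -- uniform approximation of `g`
  obtain ⟨δ₀, hδ₀, hU⟩ :=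
    FunctionSpaces.Torus.exists_forall_dist_convolution_le hgc (ENNReal.toReal_pos hη0 hηt)
  obtain ⟨N, hN⟩ := eventually_atTop.1 (hδ.eventually (gt_mem_nhds hδ₀))
  refine ⟨N, fun n hn => ?_⟩
  have hsupp : support (k n) ⊆ ball 0 δ₀ := (hk_supp n).trans (ball_subset_ball (hN n hn).le)
  -- the three pieces
  have hdecomp : θ ⋆ k n - θ = ((θ - g) ⋆ k n) + (g ⋆ k n - g) + (g - θ) := by
    rw [FunctionSpaces.Torus.sub_convolution hθi hgi (hk_cont n)]
    abel
  have hm1 : AEStronglyMeasurable ((θ - g) ⋆ k n) volume :=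
    (FunctionSpaces.Torus.continuous_convolution (hθi.sub hgi) (hk_cont n)).aestronglyMeasurable
  have hm2 : AEStronglyMeasurable (g ⋆ k n - g) volume :=
    ((FunctionSpaces.Torus.continuous_convolution hgi (hk_cont n)).sub hgc).aestronglyMeasurable
  have hm3 : AEStronglyMeasurable (g - θ) volume :=
    hgc.aestronglyMeasurable.sub hθ.aestronglyMeasurable
  have h1 : eLpNorm ((θ - g) ⋆ k n) p volume ≤ η := by
    refine (FunctionSpaces.Torus.eLpNorm_convolution_le
      (hθ.aestronglyMeasurable.sub hgc.aestronglyMeasurable)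
      (hk_cont n).aestronglyMeasurable hp1).trans ?_
    rw [hk1 n, one_mul]
    exact hgθ
  have h2 : eLpNorm (g ⋆ k n - g) p volume ≤ η := by
    have hb : ∀ᵐ x ∂(volume : Measure (UnitAddTorus d)),
        ‖(g ⋆ k n - g) x‖ ≤ η.toReal := Eventually.of_forall fun x => by
      rw [Pi.sub_apply, FunctionSpaces.Torus.convolution_comm_real, ← dist_eq_norm]
      exact hU hsupp (hk_nn n) (hk_int n) x
    refine (eLpNorm_le_of_ae_bound hb).trans ?_
    rw [measure_univ, ENNReal.one_rpow, one_mul, ENNReal.ofReal_toReal hηt]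
  have h3 : eLpNorm (g - θ) p volume ≤ η := by
    rw [eLpNorm_sub_comm]
    exact hgθ
  calc eLpNorm (θ ⋆ k n - θ) p volume
      ≤ eLpNorm (((θ - g) ⋆ k n) + (g ⋆ k n - g)) p volume +
          eLpNorm (g - θ) p volume := by
        rw [hdecomp]
        exact eLpNorm_add_le (hm1.add hm2) hm3 hp1
    _ ≤ η + η + η := by
        gcongr
        exact (eLpNorm_add_le hm1 hm2 hp1).trans (add_le_add h1 h2)
    _ = ε' := by rw [hη, ENNReal.add_thirds]
    _ ≤ ε := min_le_left _ _

/-- **Young's inequality for vector mollification**, `1 ≤ p`: `‖v ⋆ K‖_{L^p} ≤ (#d) ‖v‖_{L^p}`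
for `v ∈ L¹(T^d; ℝ^d)` and a continuous kernel `K ≥ 0` of unit mass (componentwise Young,
`Torus.eLpNorm_convolution_le`, and `‖w‖ ≤ ∑ᵢ ‖wᵢ‖`, `‖wᵢ‖ ≤ ‖w‖`; the exponent-`2` case for the
standard kernel is the tree's `Torus.eLpNorm_vecConv_kernel_le`). [folklore] -/
theorem eLpNorm_vecConv_le_card_mul {v : UnitAddTorus d → EuclideanSpace ℝ d}
    (hv : Integrable v volume) {K : UnitAddTorus d → ℝ} (hKc : Continuous K)
    (hK0 : ∀ y, 0 ≤ K y) (hK1 : ∫ y, K y = 1) {p : ℝ≥0∞} (hp1 : 1 ≤ p) :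
    eLpNorm (vecConv v K) p volume ≤ Fintype.card d * eLpNorm v p volume := by
  have hvi : ∀ i, Integrable (fun y => v y i) volume := fun i =>
    (EuclideanSpace.proj (𝕜 := ℝ) i).integrable_comp hv
  have hK1' : ∫⁻ y, ‖K y‖ₑ = 1 := by
    rw [FunctionSpaces.Torus.lintegral_enorm_eq_ofReal_integral hKc.integrable_unitAddTorus hK0,
      hK1, ENNReal.ofReal_one]
  set Fi : d → UnitAddTorus d → ℝ := fun i x => ‖((fun y => v y i) ⋆ K) x‖ with hFi
  have hFim : ∀ i, AEStronglyMeasurable (Fi i) volume := fun i =>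
    (FunctionSpaces.Torus.continuous_convolution (hvi i) hKc).norm.aestronglyMeasurable
  have h1 : eLpNorm (vecConv v K) p volume ≤ eLpNorm (∑ i, Fi i) p volume := by
    refine eLpNorm_mono_real fun x => ?_
    rw [Finset.sum_apply]
    exact norm_le_sum_norm_apply _
  have h2 : eLpNorm (∑ i, Fi i) p volume ≤ ∑ i, eLpNorm (Fi i) p volume :=
    eLpNorm_sum_le (fun i _ => hFim i) hp1
  have h3 : ∀ i, eLpNorm (Fi i) p volume ≤ eLpNorm v p volume := fun i => by
    rw [hFi, eLpNorm_norm]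
    refine (FunctionSpaces.Torus.eLpNorm_convolution_le (hvi i).aestronglyMeasurable
      hKc.aestronglyMeasurable hp1).trans ?_
    rw [hK1', one_mul]
    exact eLpNorm_mono fun x => PiLp.norm_apply_le (v x) i
  calc eLpNorm (vecConv v K) p volume
      ≤ ∑ i, eLpNorm (Fi i) p volume := h1.trans h2
    _ ≤ ∑ _i : d, eLpNorm v p volume := Finset.sum_le_sum fun i _ => h3 i
    _ = Fintype.card d * eLpNorm v p volume := by simp

/-- **`L^p` convergence of vector mollification, `1 ≤ p < ∞`**: for `v ∈ L^p(T^d; ℝ^d)` and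
kernels as in `tendsto_eLpNorm_conv_sub_self_of_kernels`, `‖v ⋆ kₙ - v‖_{L^p} → 0`
(componentwise). [folklore] -/
theorem tendsto_eLpNorm_vecConv_sub_self_of_kernels {p : ℝ≥0∞} (hp1 : 1 ≤ p) (hp : p ≠ ⊤)
    {v : UnitAddTorus d → EuclideanSpace ℝ d} (hv : MemLp v p volume)
    {k : ℕ → UnitAddTorus d → ℝ} {δ : ℕ → ℝ} (hk_nn : ∀ n y, 0 ≤ k n y)
    (hk_int : ∀ n, ∫ y, k n y = 1) (hk_supp : ∀ n, support (k n) ⊆ ball 0 (δ n))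
    (hk_cont : ∀ n, Continuous (k n)) (hδ : Tendsto δ atTop (𝓝 0)) :
    Tendsto (fun n => eLpNorm (vecConv v (k n) - v) p volume) atTop (𝓝 0) := by
  have hvi : ∀ i, MemLp (fun y => v y i) p volume := fun i =>
    (EuclideanSpace.proj (𝕜 := ℝ) i).comp_memLp' hv
  set Fi : ℕ → d → UnitAddTorus d → ℝ := fun n i x =>
    ‖((fun y => v y i) ⋆ k n) x - v x i‖ with hFi
  have hsum : Tendsto (fun n => ∑ i, eLpNorm (Fi n i) p volume) atTop (𝓝 0) := by
    have h0 : Tendsto (fun n => ∑ i, eLpNorm (Fi n i) p volume) atTop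
        (𝓝 (∑ _i : d, (0 : ℝ≥0∞))) := by
      refine tendsto_finsetSum _ fun i _ => ?_
      have h := tendsto_eLpNorm_conv_sub_self_of_kernels hp1 hp (hvi i) hk_nn hk_int hk_supp
        hk_cont hδ
      refine h.congr fun n => ?_
      rw [hFi, eLpNorm_norm]
      rfl
    simpa using h0
  refine tendsto_of_tendsto_of_tendsto_of_le_of_le tendsto_const_nhds hsum
    (fun n => bot_le) fun n => ?_
  have hle : eLpNorm (vecConv v (k n) - v) p volume ≤ eLpNorm (∑ i, Fi n i) p volume := by
    refine eLpNorm_mono_real fun x => ?_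
    rw [Finset.sum_apply]
    refine (norm_le_sum_norm_apply _).trans (le_of_eq (Finset.sum_congr rfl fun i _ => ?_))
    simp [hFi, vecConv]
  refine hle.trans (eLpNorm_sum_le (fun i _ => ?_) hp1)
  exact ((FunctionSpaces.Torus.continuous_convolution ((hvi i).integrable hp1)
    (hk_cont n)).aestronglyMeasurable.sub (hvi i).aestronglyMeasurable).norm

end LpConvergence

/-! ## Exponent bookkeeping and `L^p` classes derived from `v ∈ L³` -/

section Exponents

variable {X : Type*} [MeasurableSpace X] {μ : Measure X} {E : Type*} [NormedAddCommGroup E]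

omit [Fintype d] [DecidableEq d] in
/-- `‖f‖_{L³}³ = ∫⁻ ‖f‖ₑ³`. [folklore] -/
theorem eLpNorm_three_pow_three (f : X → E) : eLpNorm f 3 μ ^ 3 = ∫⁻ x, ‖f x‖ₑ ^ 3 ∂μ := by
  have h := eLpNorm_nnreal_pow_eq_lintegral (f := f) (μ := μ) (p := (3 : ℝ≥0)) (by norm_num)
  simp only [ENNReal.coe_ofNat, NNReal.coe_ofNat, ENNReal.rpow_ofNat] at h
  exact h

omit [Fintype d] [DecidableEq d] in
/-- `‖ ‖f‖² ‖_{L^{3/2}} = ‖f‖_{L³}²`. [folklore] -/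
theorem eLpNorm_norm_sq_threeHalves (f : X → E) :
    eLpNorm (fun x => ‖f x‖ ^ 2) (3 / 2) μ = eLpNorm f 3 μ ^ 2 := by
  have h := eLpNorm_norm_rpow f (p := (3 / 2 : ℝ≥0∞)) (q := (2 : ℝ)) (μ := μ) zero_lt_two
  have e : (3 / 2 : ℝ≥0∞) * ENNReal.ofReal 2 = 3 := by
    rw [ENNReal.ofReal_ofNat, ENNReal.div_mul_cancel two_ne_zero ENNReal.ofNat_ne_top]
  rw [e, ENNReal.rpow_two] at h
  simp_rw [Real.rpow_two] at h
  exact h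

omit [Fintype d] [DecidableEq d] in
/-- **Weighted integrals against an `L¹` majorant**: if `‖G‖ ≤ C ‖F‖` pointwise with `C ≥ 0`,
then `‖∫ G‖ₑ ≤ C ∫⁻ ‖F‖ₑ`. [folklore] -/
theorem enorm_integral_le_of_norm_le_mul {G : X → ℝ} {F : X → E} {C : ℝ} (hC : 0 ≤ C)
    (h : ∀ x, ‖G x‖ ≤ C * ‖F x‖) : ‖∫ x, G x ∂μ‖ₑ ≤ ENNReal.ofReal C * ∫⁻ x, ‖F x‖ₑ ∂μ := by
  refine (enorm_integral_le_lintegral_enorm _).trans ?_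
  rw [← lintegral_const_mul' _ _ ENNReal.ofReal_ne_top]
  refine lintegral_mono fun x => ?_
  rw [← ofReal_norm, ← ofReal_norm, ← ENNReal.ofReal_mul hC]
  exact ENNReal.ofReal_le_ofReal (h x)

variable {v g : UnitAddTorus d → EuclideanSpace ℝ d} {C : ℝ}

omit [DecidableEq d] in
/-- `v ∈ L³(T^d; ℝ^d)` gives `|v|² ∈ L^{3/2}`. [folklore] -/
theorem memLp_norm_sq_of_memLp_three (hv : MemLp v 3 volume) :
    MemLp (fun x => ‖v x‖ ^ 2) (3 / 2) volume := by
  have h := hv.norm_rpow_div 2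
  refine h.ae_eq (ae_of_all _ fun x => ?_)
  simp only [ENNReal.toReal_ofNat, Real.rpow_two]

omit [DecidableEq d] in
/-- `v ∈ L³(T^d; ℝ^d)` gives `|v|² v ∈ L¹` (Mathlib's `MemLp.integrable_norm_pow'`). [folklore] -/
theorem memLp_one_norm_sq_smul (hv : MemLp v 3 volume) :
    MemLp (fun x => ‖v x‖ ^ 2 • v x) 1 volume := by
  refine memLp_one_iff_integrable.2 ((MemLp.integrable_norm_pow' hv).mono'
    ((hv.1.norm.pow 2).smul hv.1) (ae_of_all _ fun x => le_of_eq ?_))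
  rw [norm_smul, norm_pow, norm_norm, ← pow_succ]

omit [DecidableEq d] in
/-- `⟪v, g⟫ ∈ L^p` for `v ∈ L^p` and a bounded measurable `g`. [folklore] -/
theorem memLp_inner_of_bound {p : ℝ≥0∞} (hv : MemLp v p volume)
    (hgm : AEStronglyMeasurable g volume) (hgC : ∀ x, ‖g x‖ ≤ C) :
    MemLp (fun x => ⟪v x, g x⟫) p volume := by
  refine MemLp.of_le_mul (c := C) hv (hv.1.inner (𝕜 := ℝ) hgm) (ae_of_all _ fun x => ?_)
  calc ‖⟪v x, g x⟫‖ ≤ ‖v x‖ * ‖g x‖ := norm_inner_le_norm _ _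
    _ ≤ ‖v x‖ * C := mul_le_mul_of_nonneg_left (hgC x) (norm_nonneg _)
    _ = C * ‖v x‖ := mul_comm _ _

omit [DecidableEq d] in
/-- `⟪v, g⟫ v ∈ L^{3/2}` for `v ∈ L³` and a bounded measurable `g`. [folklore] -/
theorem memLp_inner_smul (hv : MemLp v 3 volume) (hgm : AEStronglyMeasurable g volume)
    (hgC : ∀ x, ‖g x‖ ≤ C) : MemLp (fun x => ⟪v x, g x⟫ • v x) (3 / 2) volume := by
  refine MemLp.of_le_mul (c := C) (memLp_norm_sq_of_memLp_three hv)
    ((hv.1.inner (𝕜 := ℝ) hgm).smul hv.1) (ae_of_all _ fun x => ?_)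
  rw [norm_smul, norm_pow, norm_norm]
  calc ‖⟪v x, g x⟫‖ * ‖v x‖ ≤ (‖v x‖ * ‖g x‖) * ‖v x‖ :=
        mul_le_mul_of_nonneg_right (norm_inner_le_norm _ _) (norm_nonneg _)
    _ ≤ (‖v x‖ * C) * ‖v x‖ := by gcongr; exact hgC x
    _ = C * ‖v x‖ ^ 2 := by ring

omit [DecidableEq d] in
/-- `‖⟪v, g⟫‖_{L^p} ≤ C ‖v‖_{L^p}` for a weight `‖g‖ ≤ C`. [folklore] -/
theorem eLpNorm_inner_le_of_bound (hgC : ∀ x, ‖g x‖ ≤ C) (p : ℝ≥0∞) :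
    eLpNorm (fun x => ⟪v x, g x⟫) p volume ≤ ENNReal.ofReal C * eLpNorm v p volume := by
  refine eLpNorm_le_mul_eLpNorm_of_ae_le_mul (ae_of_all _ fun x => ?_) p
  calc ‖⟪v x, g x⟫‖ ≤ ‖v x‖ * ‖g x‖ := norm_inner_le_norm _ _
    _ ≤ ‖v x‖ * C := mul_le_mul_of_nonneg_left (hgC x) (norm_nonneg _)
    _ = C * ‖v x‖ := mul_comm _ _

end Exponents

/-! ## The four pairings at a fixed time: limits -/

section SliceLimits

variable {v g : UnitAddTorus d → EuclideanSpace ℝ d} {b : UnitAddTorus d → ℝ} {C : ℝ}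
  {k : ℕ → UnitAddTorus d → ℝ} {δ : ℕ → ℝ}

/-- **Slice limit (A)**: for `v ∈ L³(T^d; ℝ^d)`, a bounded continuous weight `g` and kernels
`kₙ` as in `tendsto_eLpNorm_conv_sub_self_of_kernels`,
`∫ ⟪(|v|²v) ⋆ kₙ, g⟫ → ∫ |v|² ⟪v, g⟫` (`(|v|²v) ⋆ kₙ → |v|²v` in `L¹`, paired with `g ∈ L^∞`;
the tree's `FluidPDE.tendsto_setIntegral_mul_bilin`). [folklore] -/
theorem tendsto_sliceA (hv : MemLp v 3 volume) (hgm : AEStronglyMeasurable g volume)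
    (hgC : ∀ x, ‖g x‖ ≤ C)
    (hk_nn : ∀ n y, 0 ≤ k n y) (hk_int : ∀ n, ∫ y, k n y = 1)
    (hk_supp : ∀ n, support (k n) ⊆ ball 0 (δ n)) (hk_cont : ∀ n, Continuous (k n))
    (hδ : Tendsto δ atTop (𝓝 0)) :
    Tendsto (fun n => ∫ x, ⟪vecConv (fun y => ‖v y‖ ^ 2 • v y) (k n) x, g x⟫) atTop
      (𝓝 (∫ x, ‖v x‖ ^ 2 * ⟪v x, g x⟫)) := by
  have hcube := memLp_one_norm_sq_smul hv
  have hA : ∀ n, MemLp (vecConv (fun y => ‖v y‖ ^ 2 • v y) (k n)) 1 volume := fun n =>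
    memLp_of_continuous (continuous_vecConv (memLp_one_iff_integrable.1 hcube) (hk_cont n)) 1
  have hAt := tendsto_eLpNorm_vecConv_sub_self_of_kernels le_rfl ENNReal.one_ne_top hcube hk_nn
    hk_int hk_supp hk_cont hδ
  have hB : MemLp g ⊤ volume := memLp_top_of_bound hgm C (ae_of_all _ hgC)
  have hBt : Tendsto (fun _ : ℕ => eLpNorm (g - g) ⊤ volume) atTop (𝓝 0) := by
    simp only [sub_self, eLpNorm_zero]
    exact tendsto_const_nhds
  set β : EuclideanSpace ℝ d →L[ℝ] EuclideanSpace ℝ d →L[ℝ] ℝ := innerSL ℝ with hβ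
  have hβapp : ∀ a w : EuclideanSpace ℝ d, β a w = ⟪a, w⟫ := fun a w => rfl
  have h := tendsto_setIntegral_mul_bilin (μ := volume) (p := 1) (q := ⊤) le_top
    β hA hcube (fun _ => hB) hB hAt hBt
    (w := fun _ => (1 : ℝ)) (C := 1) aestronglyMeasurable_const (ae_of_all _ fun _ => by simp) univ
  simp only [Measure.restrict_univ, hβapp, one_mul, real_inner_smul_left] at h
  exact h

omit [DecidableEq d] in
/-- **Slice limit (B)**: `∫ (|v|² ⋆ kₙ) ⟪v, g⟫ → ∫ |v|² ⟪v, g⟫` (`|v|² ⋆ kₙ → |v|²` in `L^{3/2}`,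
paired with `⟪v, g⟫ ∈ L³`). [folklore] -/
theorem tendsto_sliceB (hv : MemLp v 3 volume) (hgm : AEStronglyMeasurable g volume)
    (hgC : ∀ x, ‖g x‖ ≤ C)
    (hk_nn : ∀ n y, 0 ≤ k n y) (hk_int : ∀ n, ∫ y, k n y = 1)
    (hk_supp : ∀ n, support (k n) ⊆ ball 0 (δ n)) (hk_cont : ∀ n, Continuous (k n))
    (hδ : Tendsto δ atTop (𝓝 0)) :
    Tendsto (fun n => ∫ x, ((fun y => ‖v y‖ ^ 2) ⋆ k n) x * ⟪v x, g x⟫) atTop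
      (𝓝 (∫ x, ‖v x‖ ^ 2 * ⟪v x, g x⟫)) := by
  haveI := FunctionSpaces.holderTriple_threeHalves_three
  have hsq := memLp_norm_sq_of_memLp_three hv
  have hsqi : Integrable (fun y => ‖v y‖ ^ 2) volume :=
    hsq.integrable FunctionSpaces.ennreal_one_le_three_halves
  have hA : ∀ n, MemLp ((fun y => ‖v y‖ ^ 2) ⋆ k n) (3 / 2) volume := fun n =>
    (FunctionSpaces.Torus.continuous_convolution hsqi (hk_cont n)).memLp_of_hasCompactSupport
      (HasCompactSupport.of_compactSpace _)
  have hAt := tendsto_eLpNorm_conv_sub_self_of_kernels FunctionSpaces.ennreal_one_le_three_halves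
    FunctionSpaces.ennreal_three_halves_ne_top hsq hk_nn hk_int hk_supp hk_cont hδ
  have hB : MemLp (fun x => ⟪v x, g x⟫) 3 volume := memLp_inner_of_bound hv hgm hgC
  have hBt : Tendsto (fun _ : ℕ => eLpNorm ((fun x => ⟪v x, g x⟫) - fun x => ⟪v x, g x⟫) 3 volume)
      atTop (𝓝 0) := by
    simp only [sub_self, eLpNorm_zero]
    exact tendsto_const_nhds
  have h := tendsto_setIntegral_mul_bilin (μ := volume) (p := 3 / 2) (q := 3) (by norm_num)
    (ContinuousLinearMap.mul ℝ ℝ) hA hsq (fun _ => hB) hB hAt hBt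
    (w := fun _ => (1 : ℝ)) (C := 1) aestronglyMeasurable_const (ae_of_all _ fun _ => by simp) univ
  simp only [Measure.restrict_univ, ContinuousLinearMap.mul_apply', one_mul] at h
  exact h

/-- **Slice limit (C)**: `∫ ⟪v, v ⋆ kₙ⟫ ⟪v, g⟫ → ∫ |v|² ⟪v, g⟫` (`v ⋆ kₙ → v` in `L³`, paired with
`⟪v, g⟫ v ∈ L^{3/2}`). [folklore] -/
theorem tendsto_sliceC (hv : MemLp v 3 volume) (hgm : AEStronglyMeasurable g volume)
    (hgC : ∀ x, ‖g x‖ ≤ C)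
    (hk_nn : ∀ n y, 0 ≤ k n y) (hk_int : ∀ n, ∫ y, k n y = 1)
    (hk_supp : ∀ n, support (k n) ⊆ ball 0 (δ n)) (hk_cont : ∀ n, Continuous (k n))
    (hδ : Tendsto δ atTop (𝓝 0)) :
    Tendsto (fun n => ∫ x, ⟪v x, vecConv v (k n) x⟫ * ⟪v x, g x⟫) atTop
      (𝓝 (∫ x, ‖v x‖ ^ 2 * ⟪v x, g x⟫)) := by
  haveI := FunctionSpaces.holderTriple_threeHalves_three
  have hv1 : Integrable v volume := hv.integrable (by norm_num)
  have hA := memLp_inner_smul hv hgm hgC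
  have hB : ∀ n, MemLp (vecConv v (k n)) 3 volume := fun n =>
    memLp_of_continuous (continuous_vecConv hv1 (hk_cont n)) 3
  have hBt := tendsto_eLpNorm_vecConv_sub_self_of_kernels (p := 3) (by norm_num)
    ENNReal.ofNat_ne_top hv hk_nn hk_int hk_supp hk_cont hδ
  have hAt : Tendsto (fun _ : ℕ => eLpNorm ((fun x => ⟪v x, g x⟫ • v x) - fun x => ⟪v x, g x⟫ • v x)
      (3 / 2) volume) atTop (𝓝 0) := by
    simp only [sub_self, eLpNorm_zero]
    exact tendsto_const_nhds
  set β : EuclideanSpace ℝ d →L[ℝ] EuclideanSpace ℝ d →L[ℝ] ℝ := innerSL ℝ with hβ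
  have hβapp : ∀ a w : EuclideanSpace ℝ d, β a w = ⟪a, w⟫ := fun a w => rfl
  have h := tendsto_setIntegral_mul_bilin (μ := volume) (p := 3 / 2) (q := 3) (by norm_num)
    β (fun _ => hA) hA hB hv hAt hBt
    (w := fun _ => (1 : ℝ)) (C := 1) aestronglyMeasurable_const (ae_of_all _ fun _ => by simp) univ
  simp only [Measure.restrict_univ, hβapp, one_mul, real_inner_smul_left,
    real_inner_self_eq_norm_sq] at h
  have e1 : (fun n => ∫ x, ⟪v x, vecConv v (k n) x⟫ * ⟪v x, g x⟫) =
      fun n => ∫ x, ⟪v x, g x⟫ * ⟪v x, vecConv v (k n) x⟫ := by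
    funext n
    exact integral_congr_ae (ae_of_all _ fun x => mul_comm _ _)
  have e2 : ∫ x, ‖v x‖ ^ 2 * ⟪v x, g x⟫ = ∫ x, ⟪v x, g x⟫ * ‖v x‖ ^ 2 :=
    integral_congr_ae (ae_of_all _ fun x => mul_comm _ _)
  rw [e1, e2]
  exact h

/-- **Slice limit (D)**: `∫ ⟪v, v ⋆ kₙ⟫ b → ∫ |v|² b` for a bounded measurable weight `b`
(`v ⋆ kₙ → v` in `L³`, paired with `v ∈ L^{3/2}`). [folklore] -/
theorem tendsto_sliceD (hv : MemLp v 3 volume) (hbm : AEStronglyMeasurable b volume)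
    (hbC : ∀ x, ‖b x‖ ≤ C)
    (hk_nn : ∀ n y, 0 ≤ k n y) (hk_int : ∀ n, ∫ y, k n y = 1)
    (hk_supp : ∀ n, support (k n) ⊆ ball 0 (δ n)) (hk_cont : ∀ n, Continuous (k n))
    (hδ : Tendsto δ atTop (𝓝 0)) :
    Tendsto (fun n => ∫ x, ⟪v x, vecConv v (k n) x⟫ * b x) atTop
      (𝓝 (∫ x, ‖v x‖ ^ 2 * b x)) := by
  haveI := FunctionSpaces.holderTriple_threeHalves_three
  have hv1 : Integrable v volume := hv.integrable (by norm_num)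
  have hv32 : MemLp v (3 / 2) volume := hv.mono_exponent ENNReal.half_le_self
  have hB : ∀ n, MemLp (vecConv v (k n)) 3 volume := fun n =>
    memLp_of_continuous (continuous_vecConv hv1 (hk_cont n)) 3
  have hBt := tendsto_eLpNorm_vecConv_sub_self_of_kernels (p := 3) (by norm_num)
    ENNReal.ofNat_ne_top hv hk_nn hk_int hk_supp hk_cont hδ
  have hAt : Tendsto (fun _ : ℕ => eLpNorm (v - v) (3 / 2) volume) atTop (𝓝 0) := by
    simp only [sub_self, eLpNorm_zero]
    exact tendsto_const_nhds
  set β : EuclideanSpace ℝ d →L[ℝ] EuclideanSpace ℝ d →L[ℝ] ℝ := innerSL ℝ with hβ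
  have hβapp : ∀ a w : EuclideanSpace ℝ d, β a w = ⟪a, w⟫ := fun a w => rfl
  have h := tendsto_setIntegral_mul_bilin (μ := volume) (p := 3 / 2) (q := 3) (by norm_num)
    β (fun _ => hv32) hv32 hB hv hAt hBt hbm (ae_of_all _ hbC) univ
  simp only [Measure.restrict_univ, hβapp, real_inner_self_eq_norm_sq] at h
  have e1 : (fun n => ∫ x, ⟪v x, vecConv v (k n) x⟫ * b x) =
      fun n => ∫ x, b x * ⟪v x, vecConv v (k n) x⟫ := by
    funext n
    exact integral_congr_ae (ae_of_all _ fun x => mul_comm _ _)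
  have e2 : ∫ x, ‖v x‖ ^ 2 * b x = ∫ x, b x * ‖v x‖ ^ 2 :=
    integral_congr_ae (ae_of_all _ fun x => mul_comm _ _)
  rw [e1, e2]
  exact h

end SliceLimits

/-! ## The four pairings at a fixed time: bounds -/

section SliceBounds

variable {v g : UnitAddTorus d → EuclideanSpace ℝ d} {b : UnitAddTorus d → ℝ} {C : ℝ}
  {K : UnitAddTorus d → ℝ}

/-- **Slice bound (A)**: `|∫ ⟪(|v|²v) ⋆ K, g⟫| ≤ C (#d) ‖v‖₃³` for `‖g‖ ≤ C` and a continuous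
kernel `K ≥ 0` of unit mass (Young in `L¹`). [folklore] -/
theorem enorm_sliceA_le (hv : MemLp v 3 volume) (hgC : ∀ x, ‖g x‖ ≤ C) (hC : 0 ≤ C)
    (hKc : Continuous K) (hK0 : ∀ y, 0 ≤ K y) (hK1 : ∫ y, K y = 1) :
    ‖∫ x, ⟪vecConv (fun y => ‖v y‖ ^ 2 • v y) K x, g x⟫‖ₑ ≤
      ENNReal.ofReal C * Fintype.card d * eLpNorm v 3 volume ^ 3 := by
  have hcube := memLp_one_norm_sq_smul hv
  have h1 : ‖∫ x, ⟪vecConv (fun y => ‖v y‖ ^ 2 • v y) K x, g x⟫‖ₑ ≤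
      ENNReal.ofReal C * ∫⁻ x, ‖vecConv (fun y => ‖v y‖ ^ 2 • v y) K x‖ₑ :=
    enorm_integral_le_of_norm_le_mul hC fun x => (norm_inner_le_norm _ _).trans (by
      rw [mul_comm]
      exact mul_le_mul_of_nonneg_right (hgC x) (norm_nonneg _))
  have h2 : ∫⁻ x, ‖vecConv (fun y => ‖v y‖ ^ 2 • v y) K x‖ₑ ≤ Fintype.card d * ∫⁻ x, ‖v x‖ₑ ^ 3 := by
    have h := eLpNorm_vecConv_le_card_mul (memLp_one_iff_integrable.1 hcube) hKc hK0 hK1 le_rfl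
    rw [eLpNorm_one_eq_lintegral_enorm, eLpNorm_one_eq_lintegral_enorm] at h
    refine h.trans (le_of_eq ?_)
    congr 1
    refine lintegral_congr fun x => ?_
    rw [enorm_smul, Real.enorm_eq_ofReal (sq_nonneg _), ENNReal.ofReal_pow (norm_nonneg _),
      ofReal_norm, ← pow_succ]
  rw [eLpNorm_three_pow_three]
  calc ‖∫ x, ⟪vecConv (fun y => ‖v y‖ ^ 2 • v y) K x, g x⟫‖ₑ
      ≤ ENNReal.ofReal C * ∫⁻ x, ‖vecConv (fun y => ‖v y‖ ^ 2 • v y) K x‖ₑ := h1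
    _ ≤ ENNReal.ofReal C * (Fintype.card d * ∫⁻ x, ‖v x‖ₑ ^ 3) := by gcongr
    _ = ENNReal.ofReal C * Fintype.card d * ∫⁻ x, ‖v x‖ₑ ^ 3 := by ring

omit [DecidableEq d] in
/-- **Slice bound (B)**: `|∫ (|v|² ⋆ K) ⟪v, g⟫| ≤ C ‖v‖₃³` (Hölder `(3/2, 3)` and Young in
`L^{3/2}`). [folklore] -/
theorem enorm_sliceB_le (hv : MemLp v 3 volume) (hgm : AEStronglyMeasurable g volume)
    (hgC : ∀ x, ‖g x‖ ≤ C) (hKc : Continuous K) (hK0 : ∀ y, 0 ≤ K y) (hK1 : ∫ y, K y = 1) :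
    ‖∫ x, ((fun y => ‖v y‖ ^ 2) ⋆ K) x * ⟪v x, g x⟫‖ₑ ≤
      ENNReal.ofReal C * eLpNorm v 3 volume ^ 3 := by
  have hsq := memLp_norm_sq_of_memLp_three hv
  have hsqi : Integrable (fun y => ‖v y‖ ^ 2) volume :=
    hsq.integrable FunctionSpaces.ennreal_one_le_three_halves
  have hK1' : ∫⁻ y, ‖K y‖ₑ = 1 := by
    rw [FunctionSpaces.Torus.lintegral_enorm_eq_ofReal_integral hKc.integrable_unitAddTorus hK0,
      hK1, ENNReal.ofReal_one]
  have h1 : ‖∫ x, ((fun y => ‖v y‖ ^ 2) ⋆ K) x * ⟪v x, g x⟫‖ₑ ≤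
      eLpNorm ((fun y => ‖v y‖ ^ 2) ⋆ K) (3 / 2) volume * eLpNorm (fun x => ⟪v x, g x⟫) 3 volume :=
    (enorm_integral_le_lintegral_enorm _).trans
      (FunctionSpaces.lintegral_enorm_mul_le_threeHalves_three
        (FunctionSpaces.Torus.continuous_convolution hsqi hKc).aestronglyMeasurable
        (hv.1.inner (𝕜 := ℝ) hgm))
  have h2 : eLpNorm ((fun y => ‖v y‖ ^ 2) ⋆ K) (3 / 2) volume ≤ eLpNorm v 3 volume ^ 2 := by
    refine (FunctionSpaces.Torus.eLpNorm_convolution_le hsq.1 hKc.aestronglyMeasurable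
      FunctionSpaces.ennreal_one_le_three_halves).trans ?_
    rw [hK1', one_mul, eLpNorm_norm_sq_threeHalves]
  have h3 := eLpNorm_inner_le_of_bound (v := v) hgC 3
  calc ‖∫ x, ((fun y => ‖v y‖ ^ 2) ⋆ K) x * ⟪v x, g x⟫‖ₑ
      ≤ eLpNorm ((fun y => ‖v y‖ ^ 2) ⋆ K) (3 / 2) volume * eLpNorm (fun x => ⟪v x, g x⟫) 3 volume := h1
    _ ≤ eLpNorm v 3 volume ^ 2 * (ENNReal.ofReal C * eLpNorm v 3 volume) := mul_le_mul' h2 h3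
    _ = ENNReal.ofReal C * eLpNorm v 3 volume ^ 3 := by ring

/-- **Slice bound (C)**: `|∫ ⟪v, v ⋆ K⟫ ⟪v, g⟫| ≤ C (#d) ‖v‖₃³` (Hölder `(3, 3, 3/2)` and
`(3/2, 3)`, Young in `L³`). [folklore] -/
theorem enorm_sliceC_le (hv : MemLp v 3 volume) (hgm : AEStronglyMeasurable g volume)
    (hgC : ∀ x, ‖g x‖ ≤ C) (hKc : Continuous K) (hK0 : ∀ y, 0 ≤ K y) (hK1 : ∫ y, K y = 1) :
    ‖∫ x, ⟪v x, vecConv v K x⟫ * ⟪v x, g x⟫‖ₑ ≤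
      ENNReal.ofReal C * Fintype.card d * eLpNorm v 3 volume ^ 3 := by
  haveI := FunctionSpaces.holderTriple_three_three
  have hv1 : Integrable v volume := hv.integrable (by norm_num)
  have hWc : Continuous (vecConv v K) := continuous_vecConv hv1 hKc
  have h1 : ‖∫ x, ⟪v x, vecConv v K x⟫ * ⟪v x, g x⟫‖ₑ ≤
      eLpNorm (fun x => ⟪v x, vecConv v K x⟫) (3 / 2) volume *
        eLpNorm (fun x => ⟪v x, g x⟫) 3 volume :=
    (enorm_integral_le_lintegral_enorm _).trans
      (FunctionSpaces.lintegral_enorm_mul_le_threeHalves_three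
        (hv.1.inner (𝕜 := ℝ) hWc.aestronglyMeasurable) (hv.1.inner (𝕜 := ℝ) hgm))
  have h2 : eLpNorm (fun x => ⟪v x, vecConv v K x⟫) (3 / 2) volume ≤
      eLpNorm v 3 volume * (Fintype.card d * eLpNorm v 3 volume) := by
    have h := eLpNorm_le_eLpNorm_mul_eLpNorm'_of_norm (μ := volume) (p := 3) (q := 3) (r := 3 / 2)
      hv.1 hWc.aestronglyMeasurable (fun a w => ⟪a, w⟫) 1
      (ae_of_all _ fun x => by rw [NNReal.coe_one, one_mul]; exact norm_inner_le_norm _ _)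
    rw [ENNReal.coe_one, one_mul] at h
    exact h.trans (mul_le_mul' le_rfl (eLpNorm_vecConv_le_card_mul hv1 hKc hK0 hK1 (by norm_num)))
  have h3 := eLpNorm_inner_le_of_bound (v := v) hgC 3
  calc ‖∫ x, ⟪v x, vecConv v K x⟫ * ⟪v x, g x⟫‖ₑ
      ≤ eLpNorm (fun x => ⟪v x, vecConv v K x⟫) (3 / 2) volume *
          eLpNorm (fun x => ⟪v x, g x⟫) 3 volume := h1
    _ ≤ (eLpNorm v 3 volume * (Fintype.card d * eLpNorm v 3 volume)) *
          (ENNReal.ofReal C * eLpNorm v 3 volume) := mul_le_mul' h2 h3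
    _ = ENNReal.ofReal C * Fintype.card d * eLpNorm v 3 volume ^ 3 := by ring

/-- **Slice bound (D)**: `|∫ ⟪v, v ⋆ K⟫ b| ≤ C (#d) ‖v‖₃²` for `‖b‖ ≤ C` (Hölder `(3/2, 3)`,
`‖v‖_{3/2} ≤ ‖v‖₃` on the probability space `T^d`, Young in `L³`). [folklore] -/
theorem enorm_sliceD_le (hv : MemLp v 3 volume) (hbC : ∀ x, ‖b x‖ ≤ C) (hC : 0 ≤ C)
    (hKc : Continuous K) (hK0 : ∀ y, 0 ≤ K y) (hK1 : ∫ y, K y = 1) :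
    ‖∫ x, ⟪v x, vecConv v K x⟫ * b x‖ₑ ≤
      ENNReal.ofReal C * Fintype.card d * eLpNorm v 3 volume ^ 2 := by
  haveI := FunctionSpaces.holderTriple_threeHalves_three
  have hv1 : Integrable v volume := hv.integrable (by norm_num)
  have hWc : Continuous (vecConv v K) := continuous_vecConv hv1 hKc
  have h1 : ‖∫ x, ⟪v x, vecConv v K x⟫ * b x‖ₑ ≤
      ENNReal.ofReal C * ∫⁻ x, ‖⟪v x, vecConv v K x⟫‖ₑ :=
    enorm_integral_le_of_norm_le_mul (F := fun x => ⟪v x, vecConv v K x⟫) hC fun x => by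
      rw [norm_mul, mul_comm]
      exact mul_le_mul_of_nonneg_right (hbC x) (norm_nonneg _)
  have h2 : ∫⁻ x, ‖⟪v x, vecConv v K x⟫‖ₑ ≤
      eLpNorm v 3 volume * (Fintype.card d * eLpNorm v 3 volume) := by
    have h := eLpNorm_le_eLpNorm_mul_eLpNorm'_of_norm (μ := volume) (p := 3 / 2) (q := 3) (r := 1)
      hv.1 hWc.aestronglyMeasurable (fun a w => ⟪a, w⟫) 1
      (ae_of_all _ fun x => by rw [NNReal.coe_one, one_mul]; exact norm_inner_le_norm _ _)
    rw [ENNReal.coe_one, one_mul, eLpNorm_one_eq_lintegral_enorm] at h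
    exact h.trans (mul_le_mul' (eLpNorm_le_eLpNorm_of_exponent_le ENNReal.half_le_self hv.1)
      (eLpNorm_vecConv_le_card_mul hv1 hKc hK0 hK1 (by norm_num)))
  calc ‖∫ x, ⟪v x, vecConv v K x⟫ * b x‖ₑ
      ≤ ENNReal.ofReal C * ∫⁻ x, ‖⟪v x, vecConv v K x⟫‖ₑ := h1
    _ ≤ ENNReal.ofReal C * (eLpNorm v 3 volume * (Fintype.card d * eLpNorm v 3 volume)) := by
        gcongr
    _ = ENNReal.ofReal C * Fintype.card d * eLpNorm v 3 volume ^ 2 := by ring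

end SliceBounds

/-! ## Time integration -/

section Time

omit [Fintype d] [DecidableEq d] in
/-- **Dominated convergence in time with an `ℝ≥0∞` bound**: if the `Fₙ` are measurable,
`‖Fₙ(t)‖ₑ ≤ A (1 + B(t))` a.e. with `A < ∞`, `∫⁻ B < ∞` on a finite measure space, and
`Fₙ(t) → f(t)` a.e., then `∫ Fₙ → ∫ f` (Mathlib's `tendsto_integral_of_dominated_convergence` with
the bound `(A (1 + B)).toReal`). [folklore] -/
theorem tendsto_integral_of_enorm_bound {X : Type*} [MeasurableSpace X] {μ : Measure X}
    [IsFiniteMeasure μ] {F : ℕ → X → ℝ} {f : X → ℝ} {B : X → ℝ≥0∞} {A : ℝ≥0∞} (hA : A ≠ ⊤)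
    (hFm : ∀ n, AEStronglyMeasurable (F n) μ) (hBm : AEMeasurable B μ) (hBi : ∫⁻ t, B t ∂μ < ⊤)
    (hbound : ∀ n, ∀ᵐ t ∂μ, ‖F n t‖ₑ ≤ A * (1 + B t))
    (hlim : ∀ᵐ t ∂μ, Tendsto (fun n => F n t) atTop (𝓝 (f t))) :
    Tendsto (fun n => ∫ t, F n t ∂μ) atTop (𝓝 (∫ t, f t ∂μ)) := by
  have hBfin : ∀ᵐ t ∂μ, B t < ⊤ := ae_lt_top' hBm hBi.ne
  refine tendsto_integral_of_dominated_convergence (fun t => (A * (1 + B t)).toReal) hFm ?_ ?_ hlim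
  · refine integrable_toReal_of_lintegral_ne_top
      (aemeasurable_const.mul (aemeasurable_const.add hBm)) ?_
    rw [lintegral_const_mul' _ _ hA, lintegral_add_left' aemeasurable_const, lintegral_const]
    exact ENNReal.mul_ne_top hA (ENNReal.add_ne_top.2
      ⟨ENNReal.mul_ne_top ENNReal.one_ne_top (measure_ne_top _ _), hBi.ne⟩)
  · intro n
    filter_upwards [hbound n, hBfin] with t ht hBt
    have hne : A * (1 + B t) ≠ ⊤ :=
      ENNReal.mul_ne_top hA (ENNReal.add_ne_top.2 ⟨ENNReal.one_ne_top, hBt.ne⟩)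
    exact (ENNReal.ofReal_le_iff_le_toReal hne).1 (by rwa [ofReal_norm])

variable {T : ℝ} {u : ℝ → UnitAddTorus d → EuclideanSpace ℝ d} {φ : EuclideanSpace ℝ d → ℝ}
  {G : ℝ → UnitAddTorus d → EuclideanSpace ℝ d} {b : ℝ → UnitAddTorus d → ℝ} {C : ℝ}

/-- The kernel data along a sequence of scales `yₙ ∈ (0, 1]`, `yₙ → 0`: nonnegativity, unit mass,
supports in balls of radii `yₙ (R + 1) → 0`, continuity. [folklore] -/
theorem mollifierKernel_seq (hφ : FluidPDE.IsMollifier φ) {R : ℝ} (hR : tsupport φ ⊆ closedBall 0 R)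
    {y : ℕ → ℝ} (hy : ∀ n, 0 < y n ∧ y n ≤ 1) (hy0 : Tendsto y atTop (𝓝 0)) :
    (∀ n z, 0 ≤ mollifierKernel φ (y n) z) ∧ (∀ n, ∫ z, mollifierKernel φ (y n) z = 1) ∧
      (∀ n, support (mollifierKernel φ (y n)) ⊆ ball (0 : UnitAddTorus d) (y n * (R + 1))) ∧
      (∀ n, Continuous (mollifierKernel (d := d) φ (y n))) ∧
      Tendsto (fun n => y n * (R + 1)) atTop (𝓝 0) := by
  refine ⟨fun n z => mollifierKernel_nonneg hφ (hy n).1.le z,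
    fun n => integral_mollifierKernel hφ (hy n).1,
    fun n => support_mollifierKernel_subset hR (hy n).1,
    fun n => continuous_mollifierKernel hφ (hy n).1, ?_⟩
  simpa using hy0.mul_const (R + 1)

/-- **Term (A) in time**: `∫₀ᵀ∫ ⟪(|u|²u) ⋆ K_ε, G⟫ → ∫₀ᵀ∫ |u|² ⟪u, G⟫` as `ε → 0⁺`, for a jointly
measurable `u ∈ L³((0,T) × T^d)` and a jointly measurable weight `G` bounded on `[0,T]`
(slice limit (A) integrated by dominated convergence, bound `C (#d) ∫ ‖u(t)‖³`). [folklore] -/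
theorem tendsto_termA
    (hum : AEStronglyMeasurable (uncurry u) ((volume.restrict (Ioo 0 T)).prod volume))
    (hu3 : ∫⁻ t in Ioo 0 T, ∫⁻ x, ‖u t x‖ₑ ^ 3 < ⊤) (hφ : FluidPDE.IsMollifier φ)
    (hGm : AEStronglyMeasurable (uncurry G) ((volume.restrict (Ioo 0 T)).prod volume))
    (hC0 : 0 ≤ C) (hGC : ∀ t ∈ Icc 0 T, ∀ x, ‖G t x‖ ≤ C) :
    Tendsto (fun ε => ∫ t in Ioo 0 T, ∫ x,
        ⟪vecConv (fun y => ‖u t y‖ ^ 2 • u t y) (mollifierKernel φ ε) x, G t x⟫) (𝓝[>] 0)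
      (𝓝 (∫ t in Ioo 0 T, ∫ x, ‖u t x‖ ^ 2 * ⟪u t x, G t x⟫)) := by
  set μ : Measure ℝ := volume.restrict (Ioo 0 T) with hμ
  have hslice : ∀ᵐ t ∂μ, MemLp (u t) 3 volume := ae_memLp_three_of_lintegral hum hu3
  have hGs : ∀ᵐ t ∂μ, AEStronglyMeasurable (G t) volume := hGm.prodMk_left
  have hIoo : ∀ᵐ t ∂μ, t ∈ Ioo 0 T := ae_restrict_mem measurableSet_Ioo
  have hBm : AEMeasurable (fun t => ∫⁻ x, ‖u t x‖ₑ ^ 3) μ :=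
    (hum.enorm.pow_const 3).lintegral_prod_right'
  have hcm : AEStronglyMeasurable (uncurry fun t y => ‖u t y‖ ^ 2 • u t y) (μ.prod volume) :=
    (hum.norm.pow 2).smul hum
  obtain ⟨R, hR⟩ := hφ.2.1.exists_tsupport_subset_closedBall
  refine tendsto_nhdsGT_zero_of_seq (c := 1) one_pos fun y hy hy0 => ?_
  obtain ⟨hk_nn, hk_int, hk_supp, hk_cont, hδ⟩ := mollifierKernel_seq (d := d) hφ hR hy hy0
  show Tendsto (fun n => ∫ t, (∫ x, ⟪vecConv (fun z => ‖u t z‖ ^ 2 • u t z)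
      (mollifierKernel φ (y n)) x, G t x⟫) ∂μ) atTop
    (𝓝 (∫ t, (∫ x, ‖u t x‖ ^ 2 * ⟪u t x, G t x⟫) ∂μ))
  refine tendsto_integral_of_enorm_bound (B := fun t => ∫⁻ x, ‖u t x‖ₑ ^ 3)
    (A := ENNReal.ofReal C * Fintype.card d)
    (ENNReal.mul_ne_top ENNReal.ofReal_ne_top (ENNReal.natCast_ne_top _)) ?_ hBm hu3 ?_ ?_
  · intro n
    exact ((aestronglyMeasurable_uncurry_vecConv hcm (hk_cont n)).inner (𝕜 := ℝ) hGm).integral_prod_right'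
  · intro n
    filter_upwards [hslice, hIoo] with t ht htI
    have h := enorm_sliceA_le ht (hGC t (Ioo_subset_Icc_self htI)) hC0 (hk_cont n) (hk_nn n)
      (hk_int n)
    rw [eLpNorm_three_pow_three] at h
    exact h.trans (mul_le_mul' le_rfl le_add_self)
  · filter_upwards [hslice, hGs, hIoo] with t ht hGt htI
    exact tendsto_sliceA ht hGt (hGC t (Ioo_subset_Icc_self htI)) hk_nn hk_int hk_supp hk_cont hδ

/-- **Term (B) in time**: `∫₀ᵀ∫ (|u|² ⋆ K_ε) ⟪u, G⟫ → ∫₀ᵀ∫ |u|² ⟪u, G⟫` as `ε → 0⁺`. [folklore] -/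
theorem tendsto_termB
    (hum : AEStronglyMeasurable (uncurry u) ((volume.restrict (Ioo 0 T)).prod volume))
    (hu3 : ∫⁻ t in Ioo 0 T, ∫⁻ x, ‖u t x‖ₑ ^ 3 < ⊤) (hφ : FluidPDE.IsMollifier φ)
    (hGm : AEStronglyMeasurable (uncurry G) ((volume.restrict (Ioo 0 T)).prod volume))
    (hGC : ∀ t ∈ Icc 0 T, ∀ x, ‖G t x‖ ≤ C) :
    Tendsto (fun ε => ∫ t in Ioo 0 T, ∫ x,
        ((fun y => ‖u t y‖ ^ 2) ⋆ mollifierKernel φ ε) x * ⟪u t x, G t x⟫) (𝓝[>] 0)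
      (𝓝 (∫ t in Ioo 0 T, ∫ x, ‖u t x‖ ^ 2 * ⟪u t x, G t x⟫)) := by
  set μ : Measure ℝ := volume.restrict (Ioo 0 T) with hμ
  have hslice : ∀ᵐ t ∂μ, MemLp (u t) 3 volume := ae_memLp_three_of_lintegral hum hu3
  have hGs : ∀ᵐ t ∂μ, AEStronglyMeasurable (G t) volume := hGm.prodMk_left
  have hIoo : ∀ᵐ t ∂μ, t ∈ Ioo 0 T := ae_restrict_mem measurableSet_Ioo
  have hBm : AEMeasurable (fun t => ∫⁻ x, ‖u t x‖ₑ ^ 3) μ :=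
    (hum.enorm.pow_const 3).lintegral_prod_right'
  have hsqm : AEStronglyMeasurable (uncurry fun t y => ‖u t y‖ ^ 2) (μ.prod volume) :=
    hum.norm.pow 2
  obtain ⟨R, hR⟩ := hφ.2.1.exists_tsupport_subset_closedBall
  refine tendsto_nhdsGT_zero_of_seq (c := 1) one_pos fun y hy hy0 => ?_
  obtain ⟨hk_nn, hk_int, hk_supp, hk_cont, hδ⟩ := mollifierKernel_seq (d := d) hφ hR hy hy0
  show Tendsto (fun n => ∫ t, (∫ x, ((fun z => ‖u t z‖ ^ 2) ⋆ mollifierKernel φ (y n)) x *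
      ⟪u t x, G t x⟫) ∂μ) atTop (𝓝 (∫ t, (∫ x, ‖u t x‖ ^ 2 * ⟪u t x, G t x⟫) ∂μ))
  refine tendsto_integral_of_enorm_bound (B := fun t => ∫⁻ x, ‖u t x‖ₑ ^ 3)
    (A := ENNReal.ofReal C) ENNReal.ofReal_ne_top ?_ hBm hu3 ?_ ?_
  · intro n
    exact ((FunctionSpaces.Torus.aestronglyMeasurable_uncurry_convolution
      (ContinuousLinearMap.lsmul ℝ ℝ) hsqm (hk_cont n)).mul (hum.inner (𝕜 := ℝ) hGm)).integral_prod_right'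
  · intro n
    filter_upwards [hslice, hGs, hIoo] with t ht hGt htI
    have h := enorm_sliceB_le ht hGt (hGC t (Ioo_subset_Icc_self htI)) (hk_cont n) (hk_nn n)
      (hk_int n)
    rw [eLpNorm_three_pow_three] at h
    exact h.trans (mul_le_mul' le_rfl le_add_self)
  · filter_upwards [hslice, hGs, hIoo] with t ht hGt htI
    exact tendsto_sliceB ht hGt (hGC t (Ioo_subset_Icc_self htI)) hk_nn hk_int hk_supp hk_cont hδ

/-- **Term (C) in time**: `∫₀ᵀ∫ ⟪u, u ⋆ K_ε⟫ ⟪u, G⟫ → ∫₀ᵀ∫ |u|² ⟪u, G⟫` as `ε → 0⁺`. [folklore] -/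
theorem tendsto_termC
    (hum : AEStronglyMeasurable (uncurry u) ((volume.restrict (Ioo 0 T)).prod volume))
    (hu3 : ∫⁻ t in Ioo 0 T, ∫⁻ x, ‖u t x‖ₑ ^ 3 < ⊤) (hφ : FluidPDE.IsMollifier φ)
    (hGm : AEStronglyMeasurable (uncurry G) ((volume.restrict (Ioo 0 T)).prod volume))
    (hGC : ∀ t ∈ Icc 0 T, ∀ x, ‖G t x‖ ≤ C) :
    Tendsto (fun ε => ∫ t in Ioo 0 T, ∫ x,
        ⟪u t x, vecConv (u t) (mollifierKernel φ ε) x⟫ * ⟪u t x, G t x⟫) (𝓝[>] 0)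
      (𝓝 (∫ t in Ioo 0 T, ∫ x, ‖u t x‖ ^ 2 * ⟪u t x, G t x⟫)) := by
  set μ : Measure ℝ := volume.restrict (Ioo 0 T) with hμ
  have hslice : ∀ᵐ t ∂μ, MemLp (u t) 3 volume := ae_memLp_three_of_lintegral hum hu3
  have hGs : ∀ᵐ t ∂μ, AEStronglyMeasurable (G t) volume := hGm.prodMk_left
  have hIoo : ∀ᵐ t ∂μ, t ∈ Ioo 0 T := ae_restrict_mem measurableSet_Ioo
  have hBm : AEMeasurable (fun t => ∫⁻ x, ‖u t x‖ₑ ^ 3) μ :=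
    (hum.enorm.pow_const 3).lintegral_prod_right'
  obtain ⟨R, hR⟩ := hφ.2.1.exists_tsupport_subset_closedBall
  refine tendsto_nhdsGT_zero_of_seq (c := 1) one_pos fun y hy hy0 => ?_
  obtain ⟨hk_nn, hk_int, hk_supp, hk_cont, hδ⟩ := mollifierKernel_seq (d := d) hφ hR hy hy0
  show Tendsto (fun n => ∫ t, (∫ x, ⟪u t x, vecConv (u t) (mollifierKernel φ (y n)) x⟫ *
      ⟪u t x, G t x⟫) ∂μ) atTop (𝓝 (∫ t, (∫ x, ‖u t x‖ ^ 2 * ⟪u t x, G t x⟫) ∂μ))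
  refine tendsto_integral_of_enorm_bound (B := fun t => ∫⁻ x, ‖u t x‖ₑ ^ 3)
    (A := ENNReal.ofReal C * Fintype.card d)
    (ENNReal.mul_ne_top ENNReal.ofReal_ne_top (ENNReal.natCast_ne_top _)) ?_ hBm hu3 ?_ ?_
  · intro n
    exact ((hum.inner (𝕜 := ℝ) (aestronglyMeasurable_uncurry_vecConv hum (hk_cont n))).mul
      (hum.inner (𝕜 := ℝ) hGm)).integral_prod_right'
  · intro n
    filter_upwards [hslice, hGs, hIoo] with t ht hGt htI
    have h := enorm_sliceC_le ht hGt (hGC t (Ioo_subset_Icc_self htI)) (hk_cont n) (hk_nn n)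
      (hk_int n)
    rw [eLpNorm_three_pow_three] at h
    exact h.trans (mul_le_mul' le_rfl le_add_self)
  · filter_upwards [hslice, hGs, hIoo] with t ht hGt htI
    exact tendsto_sliceC ht hGt (hGC t (Ioo_subset_Icc_self htI)) hk_nn hk_int hk_supp hk_cont hδ

/-- **Term (D) in time**: `∫₀ᵀ∫ ⟪u, u ⋆ K_ε⟫ b → ∫₀ᵀ∫ |u|² b` as `ε → 0⁺`, for a jointly measurable
scalar weight `b` bounded on `[0,T]` (bound `C (#d) (1 + ∫ ‖u(t)‖³)`). [folklore] -/
theorem tendsto_termD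
    (hum : AEStronglyMeasurable (uncurry u) ((volume.restrict (Ioo 0 T)).prod volume))
    (hu3 : ∫⁻ t in Ioo 0 T, ∫⁻ x, ‖u t x‖ₑ ^ 3 < ⊤) (hφ : FluidPDE.IsMollifier φ)
    (hbm : AEStronglyMeasurable (uncurry b) ((volume.restrict (Ioo 0 T)).prod volume))
    (hC0 : 0 ≤ C) (hbC : ∀ t ∈ Icc 0 T, ∀ x, ‖b t x‖ ≤ C) :
    Tendsto (fun ε => ∫ t in Ioo 0 T, ∫ x,
        ⟪u t x, vecConv (u t) (mollifierKernel φ ε) x⟫ * b t x) (𝓝[>] 0)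
      (𝓝 (∫ t in Ioo 0 T, ∫ x, ‖u t x‖ ^ 2 * b t x)) := by
  set μ : Measure ℝ := volume.restrict (Ioo 0 T) with hμ
  have hslice : ∀ᵐ t ∂μ, MemLp (u t) 3 volume := ae_memLp_three_of_lintegral hum hu3
  have hbs : ∀ᵐ t ∂μ, AEStronglyMeasurable (b t) volume := hbm.prodMk_left
  have hIoo : ∀ᵐ t ∂μ, t ∈ Ioo 0 T := ae_restrict_mem measurableSet_Ioo
  have hBm : AEMeasurable (fun t => ∫⁻ x, ‖u t x‖ₑ ^ 3) μ :=
    (hum.enorm.pow_const 3).lintegral_prod_right'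
  obtain ⟨R, hR⟩ := hφ.2.1.exists_tsupport_subset_closedBall
  refine tendsto_nhdsGT_zero_of_seq (c := 1) one_pos fun y hy hy0 => ?_
  obtain ⟨hk_nn, hk_int, hk_supp, hk_cont, hδ⟩ := mollifierKernel_seq (d := d) hφ hR hy hy0
  show Tendsto (fun n => ∫ t, (∫ x, ⟪u t x, vecConv (u t) (mollifierKernel φ (y n)) x⟫ * b t x) ∂μ)
    atTop (𝓝 (∫ t, (∫ x, ‖u t x‖ ^ 2 * b t x) ∂μ))
  refine tendsto_integral_of_enorm_bound (B := fun t => ∫⁻ x, ‖u t x‖ₑ ^ 3)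
    (A := ENNReal.ofReal C * Fintype.card d)
    (ENNReal.mul_ne_top ENNReal.ofReal_ne_top (ENNReal.natCast_ne_top _)) ?_ hBm hu3 ?_ ?_
  · intro n
    exact ((hum.inner (𝕜 := ℝ) (aestronglyMeasurable_uncurry_vecConv hum (hk_cont n))).mul
      hbm).integral_prod_right'
  · intro n
    filter_upwards [hslice, hIoo] with t ht htI
    have h := enorm_sliceD_le ht (hbC t (Ioo_subset_Icc_self htI)) hC0 (hk_cont n) (hk_nn n)
      (hk_int n)
    rw [← eLpNorm_three_pow_three (u t)]
    -- `M² ≤ 1 + M³` in `ℝ≥0∞`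
    have hsq : eLpNorm (u t) 3 volume ^ 2 ≤ 1 + eLpNorm (u t) 3 volume ^ 3 := by
      rcases le_total (eLpNorm (u t) 3 volume) 1 with h1 | h1
      · exact (pow_le_one₀ (by simp) h1).trans le_self_add
      · exact (pow_le_pow_right₀ h1 (by norm_num : 2 ≤ 3)).trans le_add_self
    exact h.trans (mul_le_mul' le_rfl hsq)
  · filter_upwards [hslice, hbs, hIoo] with t ht hbt htI
    exact tendsto_sliceD ht hbt (hbC t (Ioo_subset_Icc_self htI)) hk_nn hk_int hk_supp hk_cont hδ

end Time

/-! ## The discharge -/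

section Discharge

/-- **Discharge of `Torus.tendsto_mollified_transport`** (Duchon–Robert 2000, proof of Prop. 1,
p. 251: the limits `ε → 0⁺` of the mollified transport terms; Evans, *PDE*, App. C, Thm. 7 (iv)
= Evans–Gariepy, Thm. 4.1 (iii): `f ⋆ φ_ε → f` in `L^q`, `1 ≤ q < ∞`): for a jointly measurable
`u ∈ L³((0,T) × T^d)`, a mollifier `φ` with torus kernels `K_ε` and a test function `ψ`
supported in `(0,T)`, as `ε → 0⁺`,
`∫₀ᵀ∫ ⟪(|u|²u) ⋆ K_ε, ∇ψ⟫`, `∫₀ᵀ∫ (|u|² ⋆ K_ε) ⟪u, ∇ψ⟫`, `∫₀ᵀ∫ ⟪u, u ⋆ K_ε⟫ ⟪u, ∇ψ⟫` tend to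
`∫₀ᵀ∫ |u|² ⟪u, ∇ψ⟫` and `∫₀ᵀ∫ ⟪u, u ⋆ K_ε⟫ ∂ₜψ` tends to `∫₀ᵀ∫ |u|² ∂ₜψ`. Proof: right limits at
`0` are tested along sequences `εₙ → 0⁺`; at a.e. time `u(t) ∈ L³` and the slice pairings
converge by the `L^p` convergence of mollification (`L¹`, `L^{3/2}`, `L³`;
`tendsto_eLpNorm_conv_sub_self_of_kernels`) paired by Hölder with the complementary factors; the
slice limits are integrated in time by dominated convergence with the bound
`C (#d) (1 + ∫ ‖u(t)‖³) ∈ L¹(0,T)` (Young's inequality). [cite: Evans2010, App. C Thm. 7 (iv)] -/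
theorem tendsto_mollified_transport_holds : tendsto_mollified_transport (d := d) := by
  intro T u hmeas hu3 φ hφ ψ hψ
  have hum := aestronglyMeasurable_uncurry_prod hmeas
  obtain ⟨-, hdt, hgr, -⟩ := hψ.isSpaceTimeTest.isSmoothSpaceTimeOn_derived
  obtain ⟨⟨Cdt, hCdt0, hCdt⟩, hdtm⟩ := hdt.bound_and_measurable T
  obtain ⟨⟨Cgr, hCgr0, hCgr⟩, hgrm⟩ := hgr.bound_and_measurable T
  exact ⟨tendsto_termA hum hu3 hφ hgrm hCgr0 hCgr, tendsto_termB hum hu3 hφ hgrm hCgr,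
    tendsto_termC hum hu3 hφ hgrm hCgr, tendsto_termD hum hu3 hφ hdtm hCdt0 hCdt⟩

end Discharge

end Literature.Analysis.FluidPDE.Torus
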